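import Literature.AlgebraicGeometry.Motives.AbelianVariety
import Mathlib.RingTheory.Localization.Away.Basic
import HarnessLib

/-!
# No rational curves on abelian varieties — algebra of the scaling argument

First of two proof files discharging the named fact
`Literature.AlgebraicGeometry.Motives.Milne1986_projectiveLine_to_abelianVariety_const`
(Milne, *Abelian Varieties*, §3 Cor. 3.8: every `k`-morphism `ℙ¹_k → A` to an abelian variety is
constant); see `AbelianVarietyRationalCurvesProofs.lean` for the geometry and the statement of the
argument. This file contains only the polynomial-ring bookkeeping of its step 1 (every `k`-morphism
`𝔸¹_k → A` is constant): the rings `k[y]`, `k[s, t]`, `k[λ, s, t]`, the localisations `k[s, t][1/t]`,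
`k[λ, s, t][1/(λt)]`, and the `k`-algebra maps

* `q : y ↦ s/t` (the rational map `(s, t) ↦ s/t` on `D(t)`),
* `σ : (s, t) ↦ (λs, λt)` (scaling), `π : (s, t) ↦ (s, t)` (projection), `ι₀ : λ ↦ 0` (zero section),
  `ev₀` (the origin), `e₁ : (s, t) ↦ (y, 1)` (the line `t = 1`), and their extensions `σ'`, `π'`, `e₁'`
  to the localisations,

with the identities used in the proof: `ι₀ ∘ σ = ev₀`, `ι₀ ∘ π = id`, `e₁' ∘ q = id`, and the
**scaling identity** `σ' ∘ q = π' ∘ q` (`(λs)/(λt) = s/t`). Everything is PROVED; no named facts.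

## References

* J. S. Milne, *Abelian Varieties*, in Cornell–Silverman (eds.), *Arithmetic Geometry*, Springer
  1986, Ch. V, §3 Cor. 3.8 (p. 107). [Milne1986AbelianVarieties]
-/

noncomputable section

open MvPolynomial

universe u

namespace Literature.AlgebraicGeometry.Motives

/-! ## Step 1, algebra: the polynomial rings `k[y]`, `k[s,t]`, `k[λ,s,t]` and the maps between them -/

namespace AbelianVarietyRationalCurves

variable (k : Type u) [Field k]

/-- `k[y]` (one variable `y = X 0`). [folklore] -/
abbrev R₁ : Type u := MvPolynomial (Fin 1) k
/-- `k[s, t]` (`s = X 0`, `t = X 1`). [folklore] -/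
abbrev R₂ : Type u := MvPolynomial (Fin 2) k
/-- `k[λ, s, t]` (`λ = X 0`, `s = X 1`, `t = X 2`). [folklore] -/
abbrev R₃ : Type u := MvPolynomial (Fin 3) k
/-- `t ∈ k[s, t]`. [folklore] -/
abbrev tt : R₂ k := X 1
/-- `k[s, t][1/t]`, the coordinate ring of `D(t) ⊂ 𝔸²`. [folklore] -/
abbrev R₂t : Type u := Localization.Away (tt k)
/-- `λ t ∈ k[λ, s, t]`. [folklore] -/
abbrev lt : R₃ k := X 0 * X 2
/-- `k[λ, s, t][1/(λt)]`, the coordinate ring of `D(λt) ⊂ 𝔸³`. [folklore] -/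
abbrev R₃lt : Type u := Localization.Away (lt k)
/-- `1/t ∈ k[s, t][1/t]`. [folklore] -/
abbrev tinv : R₂t k := IsLocalization.Away.invSelf (S := R₂t k) (tt k)

/-- `t · (1/t) = 1`. [folklore] -/
theorem t_mul_tinv : algebraMap (R₂ k) (R₂t k) (tt k) * tinv k = 1 :=
  IsLocalization.Away.mul_invSelf (S := R₂t k) (tt k)

/-- `q : k[y] → k[s, t][1/t]`, `y ↦ s/t` (the rational map `(s, t) ↦ s/t`). [folklore] -/
def q : R₁ k →ₐ[k] R₂t k :=
  aeval fun _ ↦ algebraMap (R₂ k) (R₂t k) (X 0) * tinv k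

/-- The scaling `σ : k[s, t] → k[λ, s, t]`, `s ↦ λs`, `t ↦ λt`. [folklore] -/
def σ : R₂ k →ₐ[k] R₃ k := aeval ![X 0 * X 1, X 0 * X 2]

/-- The projection `π : k[s, t] → k[λ, s, t]`, `s ↦ s`, `t ↦ t`. [folklore] -/
def π : R₂ k →ₐ[k] R₃ k := aeval ![X 1, X 2]

/-- The section `λ = 0`: `ι₀ : k[λ, s, t] → k[s, t]`, `λ ↦ 0`, `s ↦ s`, `t ↦ t`. [folklore] -/
def ι₀ : R₃ k →ₐ[k] R₂ k := aeval ![0, X 0, X 1]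

/-- Evaluation at the origin `ev₀ : k[s, t] → k`. [folklore] -/
def ev₀ : R₂ k →ₐ[k] k := aeval ![0, 0]

/-- The line `t = 1`: `e₁ : k[s, t] → k[y]`, `s ↦ y`, `t ↦ 1`. [folklore] -/
def e₁ : R₂ k →ₐ[k] R₁ k := aeval ![X 0, 1]

/-- `ι₀ ∘ σ` is evaluation at the origin (`(λs, λt)` at `λ = 0` is `(0, 0)`). [folklore] -/
theorem ι₀_comp_σ : (ι₀ k).comp (σ k) = (Algebra.ofId k (R₂ k)).comp (ev₀ k) := by
  refine MvPolynomial.algHom_ext fun i ↦ ?_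
  fin_cases i <;> simp [ι₀, σ, ev₀]

/-- `ι₀ ∘ π = id`. [folklore] -/
theorem ι₀_comp_π : (ι₀ k).comp (π k) = AlgHom.id k _ := by
  refine MvPolynomial.algHom_ext fun i ↦ ?_
  fin_cases i <;> simp [ι₀, π]

/-- `σ` followed by the localisation `k[λ, s, t] → k[λ, s, t][1/(λt)]`, as a `k`-algebra map. [folklore] -/
def σl : R₂ k →ₐ[k] R₃lt k := ((Algebra.ofId (R₃ k) (R₃lt k)).restrictScalars k).comp (σ k)

/-- `π` followed by the localisation `k[λ, s, t] → k[λ, s, t][1/(λt)]`, as a `k`-algebra map. [folklore] -/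
def πl : R₂ k →ₐ[k] R₃lt k := ((Algebra.ofId (R₃ k) (R₃lt k)).restrictScalars k).comp (π k)

/-- `e₁(t) = 1` is a unit. [folklore] -/
theorem isUnit_e₁_tt : IsUnit (e₁ k (tt k)) := by
  simp [e₁, tt]

/-- `σ(t) = λt` is a unit in `k[λ, s, t][1/(λt)]`. [folklore] -/
theorem isUnit_σl_tt : IsUnit (σl k (tt k)) := by
  have : σl k (tt k) = algebraMap (R₃ k) (R₃lt k) (lt k) := by
    simp [σl, σ, tt, lt, Algebra.ofId_apply]
  rw [this]
  exact IsLocalization.Away.algebraMap_isUnit (lt k)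

/-- `π(t) = t` is a unit in `k[λ, s, t][1/(λt)]`. [folklore] -/
theorem isUnit_πl_tt : IsUnit (πl k (tt k)) := by
  have : πl k (tt k) = algebraMap (R₃ k) (R₃lt k) (X 2) := by simp [πl, π, tt, Algebra.ofId_apply]
  rw [this]
  exact isUnit_of_dvd_unit (map_dvd _ (dvd_mul_left (X 2 : R₃ k) (X 0)))
    (IsLocalization.Away.algebraMap_isUnit (lt k))

/-- `e₁' : k[s, t][1/t] → k[y]` extending `e₁`. [folklore] -/
def e₁' : R₂t k →ₐ[k] R₁ k := IsLocalization.Away.liftAlgHom (S := R₂t k) (tt k) (isUnit_e₁_tt k)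
/-- `σ' : k[s, t][1/t] → k[λ, s, t][1/(λt)]` extending `σ`. [folklore] -/
def σ' : R₂t k →ₐ[k] R₃lt k := IsLocalization.Away.liftAlgHom (S := R₂t k) (tt k) (isUnit_σl_tt k)
/-- `π' : k[s, t][1/t] → k[λ, s, t][1/(λt)]` extending `π`. [folklore] -/
def π' : R₂t k →ₐ[k] R₃lt k := IsLocalization.Away.liftAlgHom (S := R₂t k) (tt k) (isUnit_πl_tt k)

/-- `e₁'` on `k[s, t]`. [folklore] -/
theorem e₁'_algebraMap (r : R₂ k) : e₁' k (algebraMap (R₂ k) (R₂t k) r) = e₁ k r := by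
  rw [e₁', IsLocalization.Away.liftAlgHom_apply, IsLocalization.Away.lift_eq]; rfl

/-- `σ'` on `k[s, t]`. [folklore] -/
theorem σ'_algebraMap (r : R₂ k) : σ' k (algebraMap (R₂ k) (R₂t k) r) = σl k r := by
  rw [σ', IsLocalization.Away.liftAlgHom_apply, IsLocalization.Away.lift_eq]; rfl

/-- `π'` on `k[s, t]`. [folklore] -/
theorem π'_algebraMap (r : R₂ k) : π' k (algebraMap (R₂ k) (R₂t k) r) = πl k r := by
  rw [π', IsLocalization.Away.liftAlgHom_apply, IsLocalization.Away.lift_eq]; rfl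

/-- `e₁'(1/t) = 1`. [folklore] -/
theorem e₁'_tinv : e₁' k (tinv k) = 1 := by
  have h := congrArg (e₁' k) (t_mul_tinv k)
  rw [map_mul, e₁'_algebraMap, map_one] at h
  simpa [e₁, tt] using h

/-- `σ'(1/t) · λt = 1`. [folklore] -/
theorem σ'_tinv_mul : σ' k (tinv k) * algebraMap (R₃ k) (R₃lt k) (lt k) = 1 := by
  have h := congrArg (σ' k) (t_mul_tinv k)
  rw [map_mul, σ'_algebraMap, map_one] at h
  rw [mul_comm]
  convert h using 2
  simp [σl, σ, tt, lt, Algebra.ofId_apply]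

/-- `π'(1/t) · t = 1`. [folklore] -/
theorem π'_tinv_mul : π' k (tinv k) * algebraMap (R₃ k) (R₃lt k) (X 2) = 1 := by
  have h := congrArg (π' k) (t_mul_tinv k)
  rw [map_mul, π'_algebraMap, map_one] at h
  rw [mul_comm]
  convert h using 2
  simp [πl, π, tt, Algebra.ofId_apply]

/-- `e₁' ∘ q = id`: `y ↦ s/t ↦ y/1 = y`. [folklore] -/
theorem e₁'_comp_q : (e₁' k).comp (q k) = AlgHom.id k _ := by
  refine MvPolynomial.algHom_ext fun i ↦ ?_
  fin_cases i
  simp only [q, AlgHom.comp_apply, aeval_X, map_mul, AlgHom.coe_id, id_eq, e₁'_algebraMap, e₁'_tinv]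
  simp [e₁]

/-- **The scaling identity `(λs)/(λt) = s/t`**: `σ' ∘ q = π' ∘ q`. [folklore] -/
theorem σ'_comp_q_eq_π'_comp_q : (σ' k).comp (q k) = (π' k).comp (q k) := by
  refine MvPolynomial.algHom_ext fun i ↦ ?_
  simp only [q, AlgHom.comp_apply, aeval_X, map_mul, σ'_algebraMap, π'_algebraMap]
  have eσ : σl k (X 0) = algebraMap (R₃ k) (R₃lt k) (X 0 * X 1) := by simp [σl, σ, Algebra.ofId_apply]
  have eπ : πl k (X 0) = algebraMap (R₃ k) (R₃lt k) (X 1) := by simp [πl, π, Algebra.ofId_apply]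
  rw [eσ, eπ]
  set a := σ' k (tinv k)
  set b := π' k (tinv k)
  have ha := σ'_tinv_mul k
  have hb := π'_tinv_mul k
  have : algebraMap (R₃ k) (R₃lt k) (X 0 * X 1) * a * (b * algebraMap (R₃ k) (R₃lt k) (X 2)) =
      algebraMap (R₃ k) (R₃lt k) (X 1) * b * (a * algebraMap (R₃ k) (R₃lt k) (X 0 * X 2)) := by
    simp only [map_mul]; ring
  rwa [ha, hb, mul_one, mul_one] at this

/-- Ring-hom form: `loc ∘ σ = σ' ∘ loc`. [folklore] -/
theorem loc₃_comp_σ : (algebraMap (R₃ k) (R₃lt k)).comp (σ k : R₂ k →+* R₃ k) =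
    (σ' k : R₂t k →+* R₃lt k).comp (algebraMap (R₂ k) (R₂t k)) := by
  have h : σl k = (σ' k).comp (IsScalarTower.toAlgHom k (R₂ k) (R₂t k)) :=
    MvPolynomial.algHom_ext fun i ↦ by simp [σ'_algebraMap]
  exact congrArg AlgHom.toRingHom h

/-- Ring-hom form: `loc ∘ π = π' ∘ loc`. [folklore] -/
theorem loc₃_comp_π : (algebraMap (R₃ k) (R₃lt k)).comp (π k : R₂ k →+* R₃ k) =
    (π' k : R₂t k →+* R₃lt k).comp (algebraMap (R₂ k) (R₂t k)) := by
  have h : πl k = (π' k).comp (IsScalarTower.toAlgHom k (R₂ k) (R₂t k)) :=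
    MvPolynomial.algHom_ext fun i ↦ by simp [π'_algebraMap]
  exact congrArg AlgHom.toRingHom h

/-- Ring-hom form: `e₁' ∘ loc = e₁`. [folklore] -/
theorem e₁'_comp_loc₂ : (e₁' k : R₂t k →+* R₁ k).comp (algebraMap (R₂ k) (R₂t k)) = (e₁ k : R₂ k →+* R₁ k) := by
  have h : (e₁' k).comp (IsScalarTower.toAlgHom k (R₂ k) (R₂t k)) = e₁ k :=
    MvPolynomial.algHom_ext fun i ↦ by simp [e₁'_algebraMap]
  exact congrArg AlgHom.toRingHom h

/-- Ring-hom form of the scaling identity. [folklore] -/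
theorem σ'q_eq_π'q : (σ' k : R₂t k →+* R₃lt k).comp (q k : R₁ k →+* R₂t k) =
    (π' k : R₂t k →+* R₃lt k).comp (q k : R₁ k →+* R₂t k) :=
  congrArg AlgHom.toRingHom (σ'_comp_q_eq_π'_comp_q k)

end AbelianVarietyRationalCurves

end Literature.AlgebraicGeometry.Motives

end
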